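import Summits.PneNP.PneNP.Theses.RootDecompParityMagnification
import Literature.Computability.MetaComplexity.AtseriasMuller2025.UniformMagnification
import Literature.Computability.MetaComplexity.FarFromSparseJuntaBounds

/-!
# `RootDecompParityMagnification.SublinearRungAM` (stmt-PneNP-31123) — the decided bottom rung (zone Z1)

Node N30 of the decomp-pnenp root-decomposition cell (route `route-PneNP-RootDecompParityMagnification`)
records, as an aside and as the route's `tribunal_fit.witness`, the DECIDED cell of its size-budget dial:
the `N^{0.99}`-approximate `MCSP[2^{⌊√ℓ⌋+1}]` promise problem `Q` is not decided by P-uniform `B₂` circuit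
families of the SUB-LINEAR size `N − ⌈N^{199/200}⌉` (circuits that cannot read `N^θ` of their inputs fail
on `N^{0.99}`-far NO instances; uniformity unused).  Both ingredients are tree theorems:
`AtseriasMuller2025.apxMCSP_not_mem_PUniformSIZE_sublinear` (`FarFromSparseJuntaBounds`, census row R13
KNOWN) and the growth bound `2^{⌊√ℓ⌋+1} ≤ 2^{o(ℓ)}` proved here (`subexpParam_sqrtScale`, port of the
lens-1 g8 kernel `subexpParam_slowScale`, ParityMagnification.lean 15429395; certified closable by the cell
critic's anchor probe Anchor_N30_ParityMagnification.lean 0487edf2, 2026-08-30T08:49:16Z).  0 sorry.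
-/

namespace Summit.PneNP.PneNP.Theorems

open Filter
open Literature.Computability.MetaComplexity.AtseriasMuller2025

/-- The slow sparsity scale `σ(ℓ) = 2^{⌊√ℓ⌋+1}` is `≤ 2^{o(ℓ)}` (`SubexpParam`): for every `γ > 0`,
eventually `2^{⌊√ℓ⌋+1} ≤ 2^{γℓ}` (take `ℓ ≥ (2/γ)² + 1`).  Port of lens-1 g8 `subexpParam_slowScale`
(decomp-pnenp cell, 2026-08-30). [folklore] -/
private theorem subexpParam_sqrtScale : SubexpParam (fun ℓ => 2 ^ (Nat.sqrt ℓ + 1)) := by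
  intro γ hγ
  rw [Filter.eventually_atTop]
  refine ⟨⌈(2 / γ) ^ 2⌉₊ + 1, fun ℓ hℓ => ?_⟩
  have hℓ1 : (1 : ℝ) ≤ (ℓ : ℝ) := by exact_mod_cast (by omega : 1 ≤ ℓ)
  have hℓγ : (2 / γ) ^ 2 ≤ (ℓ : ℝ) :=
    (Nat.le_ceil _).trans (by exact_mod_cast (by omega : ⌈(2 / γ) ^ 2⌉₊ ≤ ℓ))
  have hsq : 2 / γ ≤ Real.sqrt ℓ := by
    have h2 : (2 / γ : ℝ) = Real.sqrt ((2 / γ) ^ 2) := (Real.sqrt_sq (by positivity)).symm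
    rw [h2]
    exact Real.sqrt_le_sqrt hℓγ
  have hs1 : (1 : ℝ) ≤ Real.sqrt ℓ := by
    have := Real.sqrt_le_sqrt hℓ1
    rwa [Real.sqrt_one] at this
  have hγs : 2 ≤ γ * Real.sqrt ℓ := by
    have h := mul_le_mul_of_nonneg_left hsq hγ.le
    have h2 : γ * (2 / γ) = 2 := by field_simp
    linarith
  have hkey : (((Nat.sqrt ℓ + 1 : ℕ)) : ℝ) ≤ γ * (ℓ : ℝ) := by
    have hns : ((Nat.sqrt ℓ : ℕ) : ℝ) ≤ Real.sqrt ℓ := Real.nat_sqrt_le_real_sqrt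
    calc (((Nat.sqrt ℓ + 1 : ℕ)) : ℝ) = ((Nat.sqrt ℓ : ℕ) : ℝ) + 1 := by push_cast; ring
      _ ≤ Real.sqrt ℓ + Real.sqrt ℓ := add_le_add hns hs1
      _ = 2 * Real.sqrt ℓ := by ring
      _ ≤ (γ * Real.sqrt ℓ) * Real.sqrt ℓ := mul_le_mul_of_nonneg_right hγs (Real.sqrt_nonneg _)
      _ = γ * (ℓ : ℝ) := by rw [mul_assoc, Real.mul_self_sqrt (by positivity)]
  have hcast : (((fun ℓ => 2 ^ (Nat.sqrt ℓ + 1)) ℓ : ℕ) : ℝ) =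
      (2 : ℝ) ^ ((((Nat.sqrt ℓ + 1 : ℕ)) : ℝ)) := by
    rw [Real.rpow_natCast]
    push_cast
    rfl
  rw [hcast]
  exact Real.rpow_le_rpow_of_exponent_le (by norm_num) hkey

/-- `SublinearRungAM` (stmt-PneNP-31123): `Q := apxMCSP (gapParam (1/100)) (ℓ ↦ 2^{⌊√ℓ⌋+1}) (noSlack ·)`
is not in `PUniformSIZE (N ↦ N − ⌈N^{199/200}⌉)` — the tree theorem
`apxMCSP_not_mem_PUniformSIZE_sublinear` at `ε = 1/100`, `θ = 199/200` with the growth bound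
`subexpParam_sqrtScale` (decomp-pnenp cell N30, zone Z1 of the size-budget dial; port of lens-1 g8
`sublinear_rung` / critic `tree_sublinearRungAM_holds`, 2026-08-30). -/
theorem sublinearRungAM_proof :
    Summit.PneNP.PneNP.Theses.RootDecompParityMagnification.SublinearRungAM := by
  unfold Summit.PneNP.PneNP.Theses.RootDecompParityMagnification.SublinearRungAM
  exact apxMCSP_not_mem_PUniformSIZE_sublinear subexpParam_sqrtScale (by norm_num) (by norm_num)
    (by norm_num)

end Summit.PneNP.PneNP.Theorems
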